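import Summits.RiemannHypothesis.RiemannHypothesis.Theses.IntegerScrew
import HarnessLib

/-!
# StrategistCensus.lean — kernel-checked reductions behind STRATEGY-CENSUS.md §Decomposition
(crux-strategist re-audit r1 of `IntegerScrew.ScrewPolyFloor`, stmt-RiemannHypothesis-15757)

The level-`M` pieces of the crux `X = ScrewPolyFloor` and the two cheap equivalences that kill the
"finite head ∧ tail" (E4) and "base ∧ step" (E5) decompositions IN SUBSTANCE:

* `screwPolyFloor_of_tailPiece : TailPiece M₀ → ScrewPolyFloor` — the tail ALONE is the crux
  (nesting: `S_M` is a principal submatrix of `S_{M₀}` for `M ≤ M₀`; extend the test vector by zero),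
  so in `Head ∧ Tail → X` the head is not load-bearing ((a)) and the tail ≡ X ((c));
* `tailPiece_of_stepPiece : StepPiece M₀ → TailPiece M₀` — induction on the level; with the (true,
  finite) base inside, the step ≡ the tail ≡ X ((c)); SpectralTrace's Collapse-lemma shape.
* `screwPolyFloor_iff_tailPiece` records the equivalence.
No `sorry`; Mathlib + the route file only.
-/

-- the layout-mandated namespace repeats the summit name
set_option linter.dupNamespace false

namespace Summit.RiemannHypothesis.RiemannHypothesis.Cruxes.ScrewPolyFloor.ReauditCensus

open Summit.RiemannHypothesis.RiemannHypothesis.Theses.IntegerScrew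
open Literature.NumberTheory.LFunctions
open scoped BigOperators
open Finset

/-- The screw quadratic form at level `M`. -/
noncomputable def qf (M : ℕ) (x : ℕ → ℝ) : ℝ :=
  ∑ m ∈ Icc 2 M, ∑ m' ∈ Icc 2 M, zetaScrewKernel (Real.log m) (Real.log m') * (x m * x m')

/-- The level-`M` rung with margin `(A, c)`. -/
def FloorAt (A c : ℝ) (M : ℕ) : Prop :=
  ∀ x : ℕ → ℝ, c * (M : ℝ) ^ (-A) * ∑ m ∈ Icc 2 M, x m ^ 2 ≤ qf M x

/-- TAIL PIECE above `M₀`: some margin works at every level `M ≥ M₀`. -/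
def TailPiece (M₀ : ℕ) : Prop :=
  ∃ A c : ℝ, 0 < c ∧ ∀ M : ℕ, M₀ ≤ M → FloorAt A c M

/-- STEP PIECE: a base at `M₀` and propagation `M ↦ M + 1` with fixed constants. -/
def StepPiece (M₀ : ℕ) : Prop :=
  ∃ A c : ℝ, 0 < c ∧ FloorAt A c M₀ ∧ ∀ M : ℕ, M₀ ≤ M → FloorAt A c M → FloorAt A c (M + 1)

/-! ## Nesting: the form at level `M ≤ M'` is the form at level `M'` on the zero-extended vector -/

/-- Zero-extension of a test vector beyond level `M`. -/
noncomputable def ext (M : ℕ) (x : ℕ → ℝ) : ℕ → ℝ := fun k => if k ≤ M then x k else 0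

theorem ext_of_le {M k : ℕ} (x : ℕ → ℝ) (hk : k ≤ M) : ext M x k = x k := by simp [ext, hk]

theorem ext_of_gt {M k : ℕ} (x : ℕ → ℝ) (hk : M < k) : ext M x k = 0 := by
  simp [ext, Nat.not_le.mpr hk]

theorem sum_sq_ext {M M' : ℕ} (hMM' : M ≤ M') (x : ℕ → ℝ) :
    ∑ m ∈ Icc 2 M', ext M x m ^ 2 = ∑ m ∈ Icc 2 M, x m ^ 2 := by
  classical
  have hsub : Icc 2 M ⊆ Icc 2 M' := by
    intro k hk; simp only [mem_Icc] at hk ⊢; omega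
  rw [← Finset.sum_subset hsub]
  · exact Finset.sum_congr rfl fun k hk => by
      simp only [mem_Icc] at hk
      rw [ext_of_le x hk.2]
  · intro k hk hk'
    simp only [mem_Icc, not_and, not_le] at hk hk'
    rw [ext_of_gt x (hk' hk.1)]
    ring

theorem qf_ext {M M' : ℕ} (hMM' : M ≤ M') (x : ℕ → ℝ) : qf M' (ext M x) = qf M x := by
  classical
  have hsub : Icc 2 M ⊆ Icc 2 M' := by
    intro k hk; simp only [mem_Icc] at hk ⊢; omega
  unfold qf
  -- inner sums: restrict `m'` to `Icc 2 M`
  have inner : ∀ m : ℕ,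
      ∑ m' ∈ Icc 2 M', zetaScrewKernel (Real.log m) (Real.log m') * (ext M x m * ext M x m') =
        ∑ m' ∈ Icc 2 M, zetaScrewKernel (Real.log m) (Real.log m') * (ext M x m * x m') := by
    intro m
    rw [← Finset.sum_subset hsub]
    · exact Finset.sum_congr rfl fun m' hm' => by
        simp only [mem_Icc] at hm'
        rw [ext_of_le x hm'.2]
    · intro m' hm' hm''
      simp only [mem_Icc, not_and, not_le] at hm' hm''
      rw [ext_of_gt x (hm'' hm'.1)]
      ring
  simp_rw [inner]
  -- outer sum: restrict `m` to `Icc 2 M`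
  rw [← Finset.sum_subset hsub]
  · refine Finset.sum_congr rfl fun m hm => ?_
    simp only [mem_Icc] at hm
    exact Finset.sum_congr rfl fun m' _ => by rw [ext_of_le x hm.2]
  · intro m hm hm'
    simp only [mem_Icc, not_and, not_le] at hm hm'
    refine Finset.sum_eq_zero fun m' _ => ?_
    rw [ext_of_gt x (hm' hm.1)]
    ring

/-- NESTING: a floor at level `M'` with constant `c'` (no exponent) gives the same floor at every
lower level. -/
theorem floor_mono_level {M M' : ℕ} (hMM' : M ≤ M') {c' : ℝ}
    (h : ∀ x : ℕ → ℝ, c' * ∑ m ∈ Icc 2 M', x m ^ 2 ≤ qf M' x) (x : ℕ → ℝ) :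
    c' * ∑ m ∈ Icc 2 M, x m ^ 2 ≤ qf M x := by
  have := h (ext M x)
  rwa [sum_sq_ext hMM', qf_ext hMM'] at this

/-! ## E4: the tail alone is the crux -/

/-- **TailPiece M₀ → ScrewPolyFloor.**  Constants: `A' = max A 0`, `c' = c · M₀^{-A'}` (for `M₀ ≥ 1`;
for `M₀ = 0` the tail is literally the crux). -/
theorem screwPolyFloor_of_tailPiece (M₀ : ℕ) (h : TailPiece M₀) : ScrewPolyFloor := by
  obtain ⟨A, c, hc, hT⟩ := h
  -- normalise the exponent to `A' ≥ 0`
  set A' : ℝ := max A 0 with hA'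
  have hA'0 : 0 ≤ A' := le_max_right _ _
  have hT' : ∀ M : ℕ, M₀ ≤ M → 1 ≤ M → FloorAt A' c M := by
    intro M hM hM1 x
    have h1 := hT M hM x
    have hMr : (1 : ℝ) ≤ M := by exact_mod_cast hM1
    have hpow : (M : ℝ) ^ (-A') ≤ (M : ℝ) ^ (-A) :=
      Real.rpow_le_rpow_of_exponent_le hMr (by simp [hA'] )
    have hS : 0 ≤ ∑ m ∈ Icc 2 M, x m ^ 2 := Finset.sum_nonneg fun _ _ => sq_nonneg _
    calc c * (M : ℝ) ^ (-A') * ∑ m ∈ Icc 2 M, x m ^ 2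
        ≤ c * (M : ℝ) ^ (-A) * ∑ m ∈ Icc 2 M, x m ^ 2 :=
          mul_le_mul_of_nonneg_right (mul_le_mul_of_nonneg_left hpow hc.le) hS
      _ ≤ qf M x := h1
  rcases Nat.eq_zero_or_pos M₀ with hz | hpos
  · -- M₀ = 0: the tail is everything
    subst hz
    refine ⟨A, c, hc, fun M x => ?_⟩
    exact hT M (Nat.zero_le _) x
  · -- M₀ ≥ 1
    have hM₀r : (1 : ℝ) ≤ M₀ := by exact_mod_cast hpos
    have hM₀pos : (0 : ℝ) < M₀ := by linarith
    set c' : ℝ := c * (M₀ : ℝ) ^ (-A') with hc'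
    have hκ : 0 < (M₀ : ℝ) ^ (-A') := Real.rpow_pos_of_pos hM₀pos _
    have hκ1 : (M₀ : ℝ) ^ (-A') ≤ 1 := Real.rpow_le_one_of_one_le_of_nonpos hM₀r (by linarith)
    have hc'pos : 0 < c' := mul_pos hc hκ
    have hc'le : c' ≤ c := by
      have := mul_le_mul_of_nonneg_left hκ1 hc.le
      simpa [hc'] using this
    refine ⟨A', c', hc'pos, fun M x => ?_⟩
    have hS : 0 ≤ ∑ m ∈ Icc 2 M, x m ^ 2 := Finset.sum_nonneg fun _ _ => sq_nonneg _
    rcases le_or_gt M₀ M with hM | hM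
    · -- M ≥ M₀: use the tail with the smaller constant
      have hM1 : 1 ≤ M := le_trans hpos hM
      have h1 := hT' M hM hM1 x
      have hpow0 : 0 ≤ (M : ℝ) ^ (-A') := Real.rpow_nonneg (Nat.cast_nonneg M) _
      calc c' * (M : ℝ) ^ (-A') * ∑ m ∈ Icc 2 M, x m ^ 2
          ≤ c * (M : ℝ) ^ (-A') * ∑ m ∈ Icc 2 M, x m ^ 2 :=
            mul_le_mul_of_nonneg_right (mul_le_mul_of_nonneg_right hc'le hpow0) hS
        _ ≤ qf M x := h1
    · -- M < M₀: nesting from level M₀, where the floor is `c·M₀^{-A'} = c'`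
      have hfl : ∀ y : ℕ → ℝ, c' * ∑ m ∈ Icc 2 M₀, y m ^ 2 ≤ qf M₀ y := by
        intro y
        have := hT' M₀ le_rfl hpos y
        simpa [hc', mul_comm, mul_left_comm, mul_assoc] using this
      have hnest := floor_mono_level hM.le hfl x
      -- and `M^{-A'} ≤ 1`
      rcases Nat.eq_zero_or_pos M with hz | hMpos
      · subst hz
        simp
      · have hMr : (1 : ℝ) ≤ M := by exact_mod_cast hMpos
        have hpow1 : (M : ℝ) ^ (-A') ≤ 1 := Real.rpow_le_one_of_one_le_of_nonpos hMr (by linarith)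
        have hpow0 : 0 ≤ (M : ℝ) ^ (-A') := Real.rpow_nonneg (Nat.cast_nonneg M) _
        calc c' * (M : ℝ) ^ (-A') * ∑ m ∈ Icc 2 M, x m ^ 2
            ≤ c' * 1 * ∑ m ∈ Icc 2 M, x m ^ 2 :=
              mul_le_mul_of_nonneg_right (mul_le_mul_of_nonneg_left hpow1 hc'pos.le) hS
          _ = c' * ∑ m ∈ Icc 2 M, x m ^ 2 := by ring
          _ ≤ qf M x := hnest

/-- Conversely the crux gives every tail (trivial). -/
theorem tailPiece_of_screwPolyFloor (M₀ : ℕ) (h : ScrewPolyFloor) : TailPiece M₀ := by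
  obtain ⟨A, c, hc, hF⟩ := h
  exact ⟨A, c, hc, fun M _ x => hF M x⟩

/-- **E4 verdict, kernel-checked: `TailPiece M₀ ↔ ScrewPolyFloor` for every `M₀`.** -/
theorem screwPolyFloor_iff_tailPiece (M₀ : ℕ) : ScrewPolyFloor ↔ TailPiece M₀ :=
  ⟨tailPiece_of_screwPolyFloor M₀, screwPolyFloor_of_tailPiece M₀⟩

/-! ## E5: base ∧ step is the tail in costume -/

/-- **StepPiece M₀ → TailPiece M₀** (induction on the level). -/
theorem tailPiece_of_stepPiece (M₀ : ℕ) (h : StepPiece M₀) : TailPiece M₀ := by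
  obtain ⟨A, c, hc, hbase, hstep⟩ := h
  refine ⟨A, c, hc, fun M hM => ?_⟩
  induction M, hM using Nat.le_induction with
  | base => exact hbase
  | succ M hM ih => exact hstep M hM ih

/-- So the step piece alone is the crux. -/
theorem screwPolyFloor_of_stepPiece (M₀ : ℕ) (h : StepPiece M₀) : ScrewPolyFloor :=
  screwPolyFloor_of_tailPiece M₀ (tailPiece_of_stepPiece M₀ h)

end Summit.RiemannHypothesis.RiemannHypothesis.Cruxes.ScrewPolyFloor.ReauditCensus
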